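import Summits.ResolutionOfSingularities.ResolutionOfSingularities.Theorems.HilbertSamuelEliminationSigmaMaxModificationsCorridor3WLadderSegmentsNearLabels
import HarnessLib

/-!
# [OURS · L1 W4.2] RECOGNITION ASSEMBLY, brick M3: the marked point `x_{b+n}` is ISOLATED in the near locus `N_n` over an isolated base
# `x_b` IFF the stage `b + n` is an `Iso` stage (crux chain w42, line `w_ladder`; RULING v3.14-19 (FK); hand res-D-pv-038)

OURS (cell `res-hironaka`, slot W4.2, crux `stmt-ResolutionOfSingularities-18506` / conjunct `-19249`; `--supports … --as helper`, counted 0).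
NOT a statement of the manuscript under review [claim: Hironaka2017, status: under-review] nor of [CossartJannsenSaito2020]; AI plumbing, weaker
than expert review; fact-free, no definition.

Along a canonical near chain `c` with a blown-up isolated base stage `b` (so `x_b` is isolated in its `ν`-stratum), read on res-L1-w42-stub-1's
shifted tower `Seg.upTower … b` with near loci `N_n := (upTower b).nearLocus N x_b n ⊆ X_{b+n}`:

* `exists_isOpen_inter_nearLocus_eq_singleton_of_iso` — `Iso N (c (b+n))` ⇒ some open `O` has `O ∩ N_n = {x_{b+n}}`;
* `iso_of_isOpen_inter_nearLocus_eq_singleton` — conversely, `O ∩ N_n = {x_{b+n}}` for an open `O` ⇒ `Iso N (c (b+n))`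
  (`N_n = X_{b+n}(ν) ∩ φ_n⁻¹(U)` for an isolating open `U ∋ x_b`, stub-1's `nearLocus_eq_hsStratum_inter_preimage`, so `O ∩ φ_n⁻¹(U)` isolates
  `x_{b+n}` in its stratum; then `Seg.iso_of_stratumIsolated`);
* `not_isolated_nearLocus_of_not_iso`, `exists_closed_not_isolated_nearLocus_of_not_iso` — at a NON-`Iso` stage the marked point is a CLOSED
  near point NOT isolated in `N_n`: exactly the `hniso` input of res-L1-w42-stub-2's `inducesIsoOn_of_unit` / `dichPlus_of_unit` at the interior
  stages of a unit, while the first theorem is the `hiso` input of `not_surjective_of_unit` at the terminal stage (CJS Def. 6.38 (iv)/(v)).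

[cite: CossartJannsenSaito2020, Def. 6.38 (iii)–(v), Def. 13.3, p. 105]
-/

noncomputable section

set_option linter.dupNamespace false -- namespace `…Corridor3.Moving` re-enters `…Corridor3` (module convention of the Moving files)

open CategoryTheory AlgebraicGeometry TopologicalSpace Topology IsLocalRing
open Literature.AlgebraicGeometry.Resolution Literature.RingTheory.HilbertSamuel
open Literature.AlgebraicGeometry.CossartJannsenSaito2020
open Summit.ResolutionOfSingularities.ResolutionOfSingularities.Theorems.CampaignW42
open Summit.ResolutionOfSingularities.ResolutionOfSingularities.Theorems.SigmaMaxModificationsCorridor3.Helpers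

namespace Summit.ResolutionOfSingularities.ResolutionOfSingularities.Theorems.SigmaMaxModificationsCorridor3.Moving.Seg

variable {R : ∀ S : Scheme.{0}, CentreSeq S → Prop} {N : ℕ} {ν : ℕ → ℕ} {k : Type} [Field k]
  {c : ℕ → MarkedStage.{0}} (hc : ∀ n, CanonicalNearStep R N ν (c n) (c (n + 1))) (hRa : OracleAdmissible R)
  (hν : ν ≠ iterPSum N Phi) (h0 : Helpers.CycleInv k N ν (c 0))
  {p : ℕ} {X : Scheme.{0}} [IsLocallyNoetherian X] {x : X} (hX : IsMaximalOrigin p N ν X x)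
  (hreach : Reaches R N ν (MarkedStage.init X x) (c 0))

include hX hreach in
/-- **`Iso` at stage `b + n` ⇒ the marked point is isolated in the near locus `N_n`** (`N_n` lies in the `ν`-stratum, in which `x_{b+n}` is
isolated). [cite: CossartJannsenSaito2020, Def. 13.3, Def. 6.38 (v)] -/
theorem exists_isOpen_inter_nearLocus_eq_singleton_of_iso (b n : ℕ) (hiso : Iso N (c (b + n))) :
    ∃ O : Set (c (b + n)).W, IsOpen O ∧ O ∩ (upTower hc hRa hν h0 b).nearLocus N (c b).pt n = {(c (b + n)).pt} := by
  obtain ⟨O, hO, hptO, hOiso⟩ := stratumIsolated_at hc hRa hν hX hreach (b + n) hiso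
  refine ⟨O, hO, Set.Subset.antisymm ?_ ?_⟩
  · rintro w ⟨hwO, hwN⟩
    exact hOiso ⟨hwO, nearLocus_subset_hsStratum hc hRa hν h0 hX hreach b n hwN⟩
  · rintro w rfl
    exact ⟨hptO, pt_mem_nearLocus hc hRa hν h0 hX hreach b n⟩

include hX hreach in
/-- **An open set isolating the marked point in `N_n` makes the stage `Iso`** (base `x_b` isolated in its stratum): with `U ∋ x_b` isolating,
`N_n = X_{b+n}(ν) ∩ φ_n⁻¹(U)`, so `O ∩ φ_n⁻¹(U)` isolates `x_{b+n}` in `X_{b+n}(ν)`, hence in the Hilbert–Samuel locus.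
[cite: CossartJannsenSaito2020, Def. 13.3, Def. 6.38 (iii)] -/
theorem iso_of_isOpen_inter_nearLocus_eq_singleton (b : ℕ)
    (hU : ∃ U : Set (c b).W, IsOpen U ∧ (c b).pt ∈ U ∧ U ∩ Scheme.hsStratum (c b).W N ν ⊆ {(c b).pt}) (n : ℕ)
    {O : Set (c (b + n)).W} (hO : IsOpen O) (hOeq : O ∩ (upTower hc hRa hν h0 b).nearLocus N (c b).pt n = {(c (b + n)).pt}) :
    Iso N (c (b + n)) := by
  obtain ⟨U, hUo, hbU, hUiso⟩ := hU
  have hptO : (c (b + n)).pt ∈ O := by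
    have h : (c (b + n)).pt ∈ O ∩ (upTower hc hRa hν h0 b).nearLocus N (c b).pt n := by rw [hOeq]; exact Set.mem_singleton _
    exact h.1
  refine iso_of_stratumIsolated (cycleInv_at hc hRa hν h0 (b + n))
    (nearLocus_subset_hsStratum hc hRa hν h0 hX hreach b n (pt_mem_nearLocus hc hRa hν h0 hX hreach b n))
    ⟨O ∩ ((upTower hc hRa hν h0 b).phi n).base ⁻¹' U, hO.inter (hUo.preimage ((upTower hc hRa hν h0 b).phi n).continuous),
      ⟨hptO, by rw [Set.mem_preimage, upTower_phi_pt]; exact hbU⟩, ?_⟩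
  rintro w ⟨⟨hwO, hwU⟩, hwY⟩
  have hwN : w ∈ (upTower hc hRa hν h0 b).nearLocus N (c b).pt n := by
    rw [nearLocus_eq_hsStratum_inter_preimage hc hRa hν h0 hX hreach b hbU hUiso n]; exact ⟨hwY, hwU⟩
  have h : w ∈ O ∩ (upTower hc hRa hν h0 b).nearLocus N (c b).pt n := ⟨hwO, hwN⟩
  rw [hOeq] at h
  exact h

include hX hreach in
/-- **`x_{b+n}` isolated in `N_n` ⟺ `Iso` at stage `b + n`** (base isolated in its stratum). [cite: CossartJannsenSaito2020, Def. 13.3] -/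
theorem exists_isOpen_inter_nearLocus_eq_singleton_iff_iso (b : ℕ)
    (hU : ∃ U : Set (c b).W, IsOpen U ∧ (c b).pt ∈ U ∧ U ∩ Scheme.hsStratum (c b).W N ν ⊆ {(c b).pt}) (n : ℕ) :
    (∃ O : Set (c (b + n)).W, IsOpen O ∧ O ∩ (upTower hc hRa hν h0 b).nearLocus N (c b).pt n = {(c (b + n)).pt}) ↔ Iso N (c (b + n)) :=
  ⟨fun ⟨_, hO, hOeq⟩ => iso_of_isOpen_inter_nearLocus_eq_singleton hc hRa hν h0 hX hreach b hU n hO hOeq,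
    exists_isOpen_inter_nearLocus_eq_singleton_of_iso hc hRa hν h0 hX hreach b n⟩

include hX hreach in
/-- **At a NON-`Iso` stage the marked point is NOT isolated in `N_n`.** [cite: CossartJannsenSaito2020, Def. 13.3, Def. 6.38 (iv)] -/
theorem not_isolated_nearLocus_of_not_iso (b : ℕ)
    (hU : ∃ U : Set (c b).W, IsOpen U ∧ (c b).pt ∈ U ∧ U ∩ Scheme.hsStratum (c b).W N ν ⊆ {(c b).pt}) (n : ℕ)
    (hniso : ¬ Iso N (c (b + n))) :
    ¬ ∃ O : Set (c (b + n)).W, IsOpen O ∧ O ∩ (upTower hc hRa hν h0 b).nearLocus N (c b).pt n = {(c (b + n)).pt} :=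
  fun h => hniso ((exists_isOpen_inter_nearLocus_eq_singleton_iff_iso hc hRa hν h0 hX hreach b hU n).mp h)

include hX hreach in
/-- **The `hniso` input of the unit's interior stages, verbatim shape**: at a non-`Iso` stage `b + n`, `N_n` contains a CLOSED point (the marked
point) that is not isolated in it. [cite: CossartJannsenSaito2020, Def. 6.38 (iv), p. 104] -/
theorem exists_closed_not_isolated_nearLocus_of_not_iso (b : ℕ)
    (hU : ∃ U : Set (c b).W, IsOpen U ∧ (c b).pt ∈ U ∧ U ∩ Scheme.hsStratum (c b).W N ν ⊆ {(c b).pt}) (n : ℕ)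
    (hniso : ¬ Iso N (c (b + n))) :
    ∃ z ∈ (upTower hc hRa hν h0 b).nearLocus N (c b).pt n, IsClosed ({z} : Set (c (b + n)).W) ∧
      ¬ ∃ O : Set (c (b + n)).W, IsOpen O ∧ O ∩ (upTower hc hRa hν h0 b).nearLocus N (c b).pt n = {z} :=
  ⟨(c (b + n)).pt, pt_mem_nearLocus hc hRa hν h0 hX hreach b n, Reaches.isClosed_pt hX.isClosed (reaches_chain hreach hc (b + n)),
    not_isolated_nearLocus_of_not_iso hc hRa hν h0 hX hreach b hU n hniso⟩

include hX hreach in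
/-- The same inputs keyed by `Iso N (c b)` at the base instead of an isolating open (the base of a unit is an `Iso` stage).
[cite: CossartJannsenSaito2020, Def. 13.3] -/
theorem exists_closed_not_isolated_nearLocus_of_not_iso' (b : ℕ) (hb : Iso N (c b)) (n : ℕ) (hniso : ¬ Iso N (c (b + n))) :
    ∃ z ∈ (upTower hc hRa hν h0 b).nearLocus N (c b).pt n, IsClosed ({z} : Set (c (b + n)).W) ∧
      ¬ ∃ O : Set (c (b + n)).W, IsOpen O ∧ O ∩ (upTower hc hRa hν h0 b).nearLocus N (c b).pt n = {z} :=
  exists_closed_not_isolated_nearLocus_of_not_iso hc hRa hν h0 hX hreach b (stratumIsolated_at hc hRa hν hX hreach b hb) n hniso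

end Summit.ResolutionOfSingularities.ResolutionOfSingularities.Theorems.SigmaMaxModificationsCorridor3.Moving.Seg

end
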